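import Summits.CriticalPhenomena.SAWScalingLimit.Theorems.SAWCircleScreeningScreeningRecursionWalks
import Summits.CriticalPhenomena.SAWScalingLimit.Theorems.SAWCircleScreeningScreeningRecursionGeomB
import Literature.Probability.LatticeModels.MeshDomainBigComponents
import HarnessLib

/-!
# Screening recursion for `SAWCircleScreening`, part VII: the domain Markov property

Route `SAWCircleScreening` of `CriticalPhenomena/SAWScalingLimit`, support item
`ScreeningRecursion` (stmt-CriticalPhenomena-5468). Instance of the cylinder factorisation of
part I (`law_cylinder_split`): conditioning the critical SAW of `Ω_δ`, `Ω = Ω₀ ∖ K`, on an initial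
self-avoiding segment `α` from `a` to `v` is the critical SAW of `(Ω₀ ∖ K')_δ` from `v`, where the
new near data `K' = K ∪ δ·(α ∖ {v})` add the mesh points of the vertices of `α` other than `v`:

* `eq_or_eq_of_meshPoint_mem_segment` — a lattice edge contains no mesh point but its ends;
* `mem_closure_diff_of_finite` — removing finitely many points does not shrink closures
  elsewhere;
* `reachable_meshVertexGraph_of_walk` — walks of `Ω_δ` give reachability in the mesh graph on
  mesh vertices;
* `markov_T1`, `markov_T2` — the two support-transport hypotheses of `law_cylinder_split` for
  `(Ω₀ ∖ K, α) ↝ (Ω₀ ∖ K', v)`, under `b ∈ Ω_δ` resp. `b ∈ (Ω₀ ∖ K')_δ` (the latter is the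
  largest-component proviso supplied by part VI);
* `law_markov` — the resulting identity
  `law (Ω₀∖K) {α ≼ γ ∧ suffix ∈ T} = law (Ω₀∖K) {α ≼ γ} · law (Ω₀∖K') {support ∈ T}`.

Folklore (Madras–Slade 1993 §1.2; Lawler–Schramm–Werner 2004 §3.1). Mathlib anchors:
`SimpleGraph.Walk.transfer`, `Walk.take/drop`, `List.IsPrefix`.
-/

noncomputable section

open Set Metric Complex MeasureTheory
open Literature.Probability.LatticeModels
open Literature.Probability.RandomPlanarGeometry
open Literature.Probability.RandomPlanarGeometry.SAW

namespace Summit.CriticalPhenomena.SAWScalingLimit.Theorems.ScreeningRecursion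

/-! ## Lattice edges contain no third mesh point -/

/-- `meshPoint δ` is injective for `δ ≠ 0`. [folklore] -/
theorem meshPoint_injective {δ : ℝ} (hδ : δ ≠ 0) : Function.Injective (meshPoint δ) := by
  intro x y h
  have := congrArg (nearestSite δ) h
  rwa [nearestSite_meshPoint hδ, nearestSite_meshPoint hδ] at this

/-- A mesh point lying on the closed segment of a lattice edge is one of its endpoints.
[folklore] -/
theorem eq_or_eq_of_meshPoint_mem_segment {δ : ℝ} (hδ : δ ≠ 0) {u w x : Site 2}
    (huw : (zdGraph 2).Adj u w) (hx : meshPoint δ x ∈ segment ℝ (meshPoint δ u) (meshPoint δ w)) :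
    x = u ∨ x = w := by
  -- reduce to `w = u + single i 1` by symmetry
  wlog h : ∃ i, w = u + Pi.single i 1 generalizing u w
  · obtain ⟨i, hi | hi⟩ := (zdGraph_adj_iff u w).1 huw
    · exact this huw hx ⟨i, hi⟩
    · rw [segment_symm] at hx
      rcases this huw.symm hx ⟨i, hi⟩ with h1 | h1
      · exact Or.inr h1
      · exact Or.inl h1
  obtain ⟨i, rfl⟩ := h
  rw [segment_eq_image] at hx
  obtain ⟨θ, ⟨hθ0, hθ1⟩, hθ⟩ := hx
  rw [meshPoint_add] at hθ
  -- coordinates: `x = u + θ single i 1` as real vectors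
  have hcoord : ∀ j : Fin 2, ((x j : ℤ) : ℝ) = (u j : ℝ) + θ * (if j = i then 1 else 0) := by
    intro j
    have hre := congrArg Complex.re hθ
    have him := congrArg Complex.im hθ
    simp only [Complex.real_smul, Complex.add_re, Complex.mul_re, Complex.ofReal_re,
      Complex.ofReal_im, meshPoint_re, meshPoint_im, zero_mul, sub_zero,
      Complex.add_im, Complex.mul_im, add_zero, toComplex_single, Int.cast_one, one_mul] at hre him
    have hδ' : (δ : ℝ) ≠ 0 := hδ
    fin_cases i <;> fin_cases j
    · simp at hre ⊢
      have : δ * (x 0 : ℝ) = δ * ((u 0 : ℝ) + θ) := by linarith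
      exact mul_left_cancel₀ hδ' this
    · simp at him ⊢
      have : δ * (x 1 : ℝ) = δ * (u 1 : ℝ) := by linarith
      exact_mod_cast mul_left_cancel₀ hδ' this
    · simp at hre ⊢
      have : δ * (x 0 : ℝ) = δ * (u 0 : ℝ) := by linarith
      exact_mod_cast mul_left_cancel₀ hδ' this
    · simp at him ⊢
      have : δ * (x 1 : ℝ) = δ * ((u 1 : ℝ) + θ) := by linarith
      exact mul_left_cancel₀ hδ' this
  -- `θ = x i - u i` is an integer in `[0, 1]`
  have hθint : θ = ((x i - u i : ℤ) : ℝ) := by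
    have := hcoord i
    simp only [if_true] at this
    push_cast
    linarith
  have hcases : x i - u i = 0 ∨ x i - u i = 1 := by
    have h0 : (0 : ℝ) ≤ ((x i - u i : ℤ) : ℝ) := hθint ▸ hθ0
    have h1 : ((x i - u i : ℤ) : ℝ) ≤ 1 := hθint ▸ hθ1
    have h0' : (0 : ℤ) ≤ x i - u i := by exact_mod_cast h0
    have h1' : x i - u i ≤ 1 := by exact_mod_cast h1
    omega
  rcases hcases with h0 | h1
  · left
    funext j
    have := hcoord j
    by_cases hji : j = i
    · subst hji; omega
    · rw [if_neg hji, mul_zero, add_zero] at this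
      exact_mod_cast this
  · right
    funext j
    have := hcoord j
    rw [Pi.add_apply, Pi.single_apply]
    by_cases hji : j = i
    · subst hji; rw [if_pos rfl]; omega
    · rw [if_neg hji, mul_zero, add_zero] at this
      rw [if_neg hji, add_zero]
      exact_mod_cast this

/-! ## Closures and finite exceptional sets -/

/-- Removing a finite set `F` from `S` keeps every point of `S̄ ∖ F` in the closure. [folklore] -/
theorem mem_closure_diff_of_finite {S F : Set ℂ} (hF : F.Finite) {z : ℂ} (hz : z ∈ closure S)
    (hzF : z ∉ F) : z ∈ closure (S \ F) := by
  have hU : IsOpen Fᶜ := hF.isClosed.isOpen_compl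
  have h1 : z ∈ closure (Fᶜ ∩ S) := hU.inter_closure ⟨hzF, hz⟩
  have hsub : Fᶜ ∩ S ⊆ S \ F := fun w hw => ⟨hw.2, hw.1⟩
  exact closure_mono hsub h1

/-! ## From walks of `Ω_δ` to reachability in the mesh graph on mesh vertices -/

/-- A walk of `Ω_δ = discreteDomainGraph Ω δ` from a mesh vertex `x` to `y` makes `x`, `y`
reachable in the mesh graph of `Ω` on mesh vertices. [folklore] -/
theorem reachable_meshVertexGraph_of_walk {Ω : Set ℂ} {δ : ℝ} {x y : Site 2}
    (q : (discreteDomainGraph Ω δ).Walk x y) (hx : x ∈ meshVertices Ω δ) :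
    ∃ hy : y ∈ meshVertices Ω δ, (meshVertexGraph Ω δ).Reachable ⟨x, hx⟩ ⟨y, hy⟩ := by
  induction q with
  | nil => exact ⟨hx, SimpleGraph.Reachable.refl _⟩
  | cons hadj q ih =>
    rename_i v w z
    obtain ⟨hm, -, hwdom⟩ := discreteDomainGraph_adj_iff.1 hadj
    have hw : w ∈ meshVertices Ω δ := meshDomain_subset_meshVertices Ω δ hwdom
    obtain ⟨hz, hr⟩ := ih hw
    refine ⟨hz, SimpleGraph.Reachable.trans (SimpleGraph.Adj.reachable ?_) hr⟩
    exact hm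

/-- A walk of `Ω_δ` whose vertices have mesh points in `Ω'` and whose closed edges lie in `Ω̄'`
makes its endpoints reachable in the mesh graph of `Ω'` on mesh vertices. [folklore] -/
theorem reachable_meshVertexGraph_of_walk_of_subset {Ω Ω' : Set ℂ} {δ : ℝ} {x y : Site 2}
    (q : (discreteDomainGraph Ω δ).Walk x y) (hx : x ∈ meshVertices Ω' δ)
    (hV : ∀ w ∈ q.support, meshPoint δ w ∈ Ω')
    (hE : ∀ e ∈ q.edges, ∀ x' y', e = s(x', y') →
      segment ℝ (meshPoint δ x') (meshPoint δ y') ⊆ closure Ω') :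
    ∃ hy : y ∈ meshVertices Ω' δ, (meshVertexGraph Ω' δ).Reachable ⟨x, hx⟩ ⟨y, hy⟩ := by
  induction q with
  | nil => exact ⟨hx, SimpleGraph.Reachable.refl _⟩
  | cons hadj q ih =>
    rename_i v w z
    obtain ⟨hm, -, -⟩ := discreteDomainGraph_adj_iff.1 hadj
    rw [meshGraph_adj_iff] at hm
    have hw : w ∈ meshVertices Ω' δ := hV w (by simp)
    obtain ⟨hz, hr⟩ := ih hw (fun t ht => hV t (by simp [ht]))
      (fun e he x' y' hexy => hE e (by simp [he]) x' y' hexy)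
    refine ⟨hz, SimpleGraph.Reachable.trans (SimpleGraph.Adj.reachable ?_) hr⟩
    change (meshGraph Ω' δ).Adj v w
    exact meshGraph_adj_iff.2 ⟨hm.1, hE s(v, w) (by simp) v w rfl⟩

/-- All vertices of a NON-trivial walk of `Ω_δ` belong to `Ω_δ` (every vertex is an endpoint of
an edge, and edges of `Ω_δ` join points of `Ω_δ`). [folklore] -/
theorem mem_meshDomain_of_mem_support {Ω : Set ℂ} {δ : ℝ} {x y : Site 2}
    (q : (discreteDomainGraph Ω δ).Walk x y) (hq : ¬ q.Nil) {w : Site 2} (hw : w ∈ q.support) :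
    w ∈ meshDomain Ω δ := by
  induction q with
  | nil => exact absurd SimpleGraph.Walk.Nil.nil hq
  | cons hadj q ih =>
    rename_i u u' z
    rw [SimpleGraph.Walk.support_cons, List.mem_cons] at hw
    rcases hw with rfl | hw
    · exact (discreteDomainGraph_adj_iff.1 hadj).2.1
    · by_cases hqn : q.Nil
      · rw [SimpleGraph.Walk.nil_iff_support_eq.1 hqn, List.mem_singleton] at hw
        rw [hw]
        exact (discreteDomainGraph_adj_iff.1 hadj).2.2
      · exact ih hqn hw

/-! ## The domain Markov transport -/

section Markov

variable {Ω₀ K : Set ℂ} {δ : ℝ} {a v b : Site 2}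

/-- The support of a walk is its `dropLast` followed by the endpoint. [folklore] -/
theorem support_eq_dropLast_append {G : SimpleGraph (Site 2)} {x y : Site 2} (p : G.Walk x y) :
    p.support = p.support.dropLast ++ [y] := by
  conv_lhs => rw [← List.dropLast_append_getLast (SimpleGraph.Walk.support_ne_nil p),
    SimpleGraph.Walk.getLast_support]

/-- **Markov transport, `T1`.** Every SAW of `(Ω₀ ∖ K')_δ` from `v` to `b`,
`K' = K ∪ δ·(α ∖ {v})`, concatenates with the self-avoiding prefix `α` of `(Ω₀ ∖ K)_δ` to a SAW
of `(Ω₀ ∖ K)_δ` from `a` to `b` (given `b ∈ (Ω₀ ∖ K)_δ`). [folklore] -/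
theorem markov_T1 (α : (discreteDomainGraph (Ω₀ \ K) δ).Walk a v) (hα : α.IsPath)
    (hb : b ∈ meshDomain (Ω₀ \ K) δ) {K' : Set ℂ}
    (hK' : K' = K ∪ meshPoint δ '' {x | x ∈ α.support.dropLast}) (β' : DomainSAW (Ω₀ \ K') δ v b) :
    ∃ γ : DomainSAW (Ω₀ \ K) δ a b, γ.walk.support = α.support.dropLast ++ β'.walk.support := by
  classical
  have hsub : Ω₀ \ K' ⊆ Ω₀ \ K := fun z hz => ⟨hz.1, fun h => hz.2 (hK' ▸ Or.inl h)⟩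
  by_cases hnil : β'.walk.Nil
  · -- trivial continuation: `v = b` and `γ = α`
    have hvb : v = b := hnil.eq
    subst hvb
    refine ⟨⟨α, hα⟩, ?_⟩
    rw [SimpleGraph.Walk.nil_iff_support_eq.1 hnil]
    exact support_eq_dropLast_append α
  · -- all vertices of `β'` are in `(Ω₀ ∖ K')_δ`, hence mesh vertices of `Ω₀ ∖ K'`
    have hdomK' : ∀ w ∈ β'.walk.support, w ∈ meshDomain (Ω₀ \ K') δ := fun w hw =>
      mem_meshDomain_of_mem_support β'.walk hnil hw
    have hvertK' : ∀ w ∈ β'.walk.support, w ∈ meshVertices (Ω₀ \ K') δ := fun w hw =>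
      meshDomain_subset_meshVertices _ _ (hdomK' w hw)
    have hvK' : v ∈ meshVertices (Ω₀ \ K') δ := hvertK' v (SimpleGraph.Walk.start_mem_support _)
    -- and in `(Ω₀ ∖ K)_δ`: joined to `b` there
    have hvert : ∀ w ∈ β'.walk.support, w ∈ meshDomain (Ω₀ \ K) δ := by
      intro w hw
      obtain ⟨hw', hr⟩ := reachable_meshVertexGraph_of_walk (β'.walk.takeUntil w hw) hvK'
      obtain ⟨hb', hrb⟩ := reachable_meshVertexGraph_of_walk β'.walk hvK'
      have h' := reachable_mono_domain hsub hw' hb' (hr.symm.trans hrb)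
      exact mem_meshDomain_of_reachable_meshVertexGraph hb (hsub hb') (hsub hw') h'.symm
    -- transfer `β'` to the graph of `Ω₀ ∖ K`
    have hedges : ∀ e ∈ β'.walk.edges, e ∈ (discreteDomainGraph (Ω₀ \ K) δ).edgeSet := by
      intro e he
      induction e using Sym2.ind with
      | h x y =>
        rw [SimpleGraph.mem_edgeSet]
        have hadj : (discreteDomainGraph (Ω₀ \ K') δ).Adj x y :=
          SimpleGraph.Walk.adj_of_mem_edges _ he
        obtain ⟨hm, -, -⟩ := discreteDomainGraph_adj_iff.1 hadj
        rw [meshGraph_adj_iff] at hm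
        exact discreteDomainGraph_adj_iff.2
          ⟨meshGraph_adj_iff.2 ⟨hm.1, hm.2.trans (closure_mono hsub)⟩,
          hvert x (SimpleGraph.Walk.fst_mem_support_of_mem_edges _ he),
          hvert y (SimpleGraph.Walk.snd_mem_support_of_mem_edges _ he)⟩
    set β'' := β'.walk.transfer (discreteDomainGraph (Ω₀ \ K) δ) hedges with hβ''
    have hβ''supp : β''.support = β'.walk.support := SimpleGraph.Walk.support_transfer _ _
    -- concatenate; the result is self-avoiding
    refine ⟨⟨α.append β'', ?_⟩, ?_⟩
    · rw [SimpleGraph.Walk.isPath_def, SimpleGraph.Walk.support_append, hβ''supp]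
      refine List.Nodup.append hα.support_nodup ?_ ?_
      · exact ((SimpleGraph.Walk.isPath_def _).1 β'.isPath).sublist (List.tail_sublist _)
      · intro w hwα hwβ
        by_cases hwv : w = v
        · -- `v` would occur twice in `β'.support = v :: tail`
          have hnd := (SimpleGraph.Walk.isPath_def _).1 β'.isPath
          rw [← SimpleGraph.Walk.cons_tail_support, List.nodup_cons] at hnd
          exact hnd.1 (hwv ▸ hwβ)
        · -- `w ∈ α ∖ {v}` has its mesh point in `K'`, but `w` is a mesh vertex of `Ω₀ ∖ K'`
          have hwK' : meshPoint δ w ∈ K' := by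
            rw [hK']
            refine Or.inr ⟨w, ?_, rfl⟩
            show w ∈ α.support.dropLast
            rw [support_eq_dropLast_append α, List.mem_append, List.mem_singleton] at hwα
            exact hwα.resolve_right hwv
          exact (hvertK' w (List.mem_of_mem_tail hwβ)).2 hwK'
    · show (α.append β'').support = α.support.dropLast ++ β'.walk.support
      rw [SimpleGraph.Walk.support_append, hβ''supp]
      conv_lhs => rw [support_eq_dropLast_append α]
      rw [List.append_assoc]
      congr 1
      rw [← SimpleGraph.Walk.cons_tail_support β'.walk]
      rfl

/-- **Markov transport, `T2`.** Every SAW `γ` of `(Ω₀ ∖ K)_δ` from `a` to `b` that starts with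
the self-avoiding prefix `α` (from `a` to `v`) continues, after `α`, as a SAW of `(Ω₀ ∖ K')_δ` from
`v` to `b`, `K' = K ∪ δ·(α ∖ {v})` (given `b ∈ (Ω₀ ∖ K')_δ`, the largest-component proviso):
the continuation avoids the vertices of `α`, its closed edges avoid their mesh points, so both
survive the removal of these finitely many points. [folklore] -/
theorem markov_T2 (hδ : 0 < δ) (α : (discreteDomainGraph (Ω₀ \ K) δ).Walk a v) {K' : Set ℂ}
    (hK' : K' = K ∪ meshPoint δ '' {x | x ∈ α.support.dropLast})
    (hb' : b ∈ meshDomain (Ω₀ \ K') δ) (γ : DomainSAW (Ω₀ \ K) δ a b)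
    (hpre : α.support <+: γ.walk.support) :
    ∃ β' : DomainSAW (Ω₀ \ K') δ v b, γ.walk.support = α.support.dropLast ++ β'.walk.support := by
  classical
  set n := α.length with hn
  set αd := α.support.dropLast with hαd
  set F : Set ℂ := meshPoint δ '' {x | x ∈ αd} with hF
  have hFfin : F.Finite := (List.finite_toSet αd).image _
  have hK'F : Ω₀ \ K' = (Ω₀ \ K) \ F := by rw [hK', Set.sdiff_sdiff]
  have hαsupp : α.support = αd ++ [v] := support_eq_dropLast_append α
  have hαdlen : αd.length = n := by
    have h1 : α.support.length = n + 1 := SimpleGraph.Walk.length_support α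
    rw [hαd, List.length_dropLast, h1]; rfl
  obtain ⟨rest, hrest⟩ := hpre
  have hsupp : γ.walk.support = αd ++ (v :: rest) := by
    rw [← hrest, hαsupp, List.append_assoc]; rfl
  have hnodup : (αd ++ (v :: rest)).Nodup := hsupp ▸ γ.isPath.support_nodup
  have hdisj : ∀ w ∈ v :: rest, w ∉ αd := fun w hw hwα =>
    (List.nodup_append.1 hnodup).2.2 w hwα w hw rfl
  have hrestnd : (v :: rest).Nodup := (List.nodup_append.1 hnodup).2.1
  -- the continuation `β₁ = γ.drop n`, a walk from `v` with support `v :: rest`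
  have hnlen : n ≤ γ.walk.length := by
    have h1 : γ.walk.support.length = γ.walk.length + 1 := SimpleGraph.Walk.length_support _
    rw [hsupp, List.length_append, List.length_cons, hαdlen] at h1
    omega
  set β₀ := γ.walk.drop n with hβ₀
  have hβ₀supp : β₀.support = v :: rest := by
    rw [hβ₀, SimpleGraph.Walk.drop_support_eq_support_drop_min, min_eq_left hnlen, hsupp,
      ← hαdlen, List.drop_left]
  have hv : γ.walk.getVert n = v := by
    have h := head?_support β₀
    rw [hβ₀supp] at h
    simpa using h.symm
  set β₁ : (discreteDomainGraph (Ω₀ \ K) δ).Walk v b := β₀.copy hv rfl with hβ₁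
  have hβ₁supp : β₁.support = v :: rest := by rw [hβ₁, SimpleGraph.Walk.support_copy, hβ₀supp]
  -- trivial continuation
  by_cases hnil : β₁.Nil
  · have hvb : v = b := hnil.eq
    subst hvb
    refine ⟨⟨SimpleGraph.Walk.nil, SimpleGraph.Walk.IsPath.nil⟩, ?_⟩
    have : v :: rest = [v] := hβ₁supp ▸ SimpleGraph.Walk.nil_iff_support_eq.1 hnil
    rw [hsupp, this]
    rfl
  -- vertices of `β₁` are mesh vertices of `Ω₀ ∖ K'`
  have hVert : ∀ w ∈ β₁.support, w ∈ meshVertices (Ω₀ \ K') δ := by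
    intro w hw
    have hwdom : w ∈ meshDomain (Ω₀ \ K) δ := mem_meshDomain_of_mem_support β₁ hnil hw
    refine ⟨(meshDomain_subset_meshVertices _ _ hwdom).1, ?_⟩
    rw [hK']
    rintro (hwK | ⟨x', hx', hxw⟩)
    · exact (meshDomain_subset_meshVertices _ _ hwdom).2 hwK
    · have := meshPoint_injective hδ.ne' hxw
      subst this
      exact hdisj x' (hβ₁supp ▸ hw) hx'
  -- closed edges of `β₁` lie in the closure of `Ω₀ ∖ K'`
  have hEdge : ∀ e ∈ β₁.edges, ∀ x' y', e = s(x', y') →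
      segment ℝ (meshPoint δ x') (meshPoint δ y') ⊆ closure (Ω₀ \ K') := by
    intro e he x' y' hexy
    subst hexy
    have hadj : (discreteDomainGraph (Ω₀ \ K) δ).Adj x' y' := SimpleGraph.Walk.adj_of_mem_edges _ he
    obtain ⟨hm, -, -⟩ := discreteDomainGraph_adj_iff.1 hadj
    rw [meshGraph_adj_iff] at hm
    intro z hz
    rw [hK'F]
    refine mem_closure_diff_of_finite hFfin (hm.2 hz) ?_
    rintro ⟨x'', hx'', rfl⟩
    have hx's : x' ∈ β₁.support := SimpleGraph.Walk.fst_mem_support_of_mem_edges _ he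
    have hy's : y' ∈ β₁.support := SimpleGraph.Walk.snd_mem_support_of_mem_edges _ he
    rcases eq_or_eq_of_meshPoint_mem_segment hδ.ne' hm.1 hz with rfl | rfl
    · exact hdisj x'' (hβ₁supp ▸ hx's) hx''
    · exact hdisj x'' (hβ₁supp ▸ hy's) hx''
  -- every vertex of `β₁` is joined to `b` in the mesh graph of `Ω₀ ∖ K'`, hence lies in `(Ω₀∖K')_δ`
  have hvK' : v ∈ meshVertices (Ω₀ \ K') δ := hVert v (SimpleGraph.Walk.start_mem_support _)
  have hDom : ∀ w ∈ β₁.support, w ∈ meshDomain (Ω₀ \ K') δ := by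
    intro w hw
    obtain ⟨hb1, hvb⟩ := reachable_meshVertexGraph_of_walk_of_subset β₁ hvK'
      (fun w hw => (hVert w hw).1 |> fun h => ⟨h, (hVert w hw).2⟩) hEdge
    obtain ⟨hw1, hvw⟩ := reachable_meshVertexGraph_of_walk_of_subset (β₁.takeUntil w hw) hvK'
      (fun t ht => let h := hVert t (SimpleGraph.Walk.support_takeUntil_subset_support _ _ ht); ⟨h.1, h.2⟩)
      (fun e he => hEdge e (SimpleGraph.Walk.edges_takeUntil_subset_edges _ _ he))
    exact mem_meshDomain_of_reachable_meshVertexGraph hb' hb1 hw1 (hvb.symm.trans hvw)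
  -- transfer `β₁` to `(Ω₀ ∖ K')_δ`
  have hedges : ∀ e ∈ β₁.edges, e ∈ (discreteDomainGraph (Ω₀ \ K') δ).edgeSet := by
    intro e he
    induction e using Sym2.ind with
    | h x y =>
      rw [SimpleGraph.mem_edgeSet]
      have hadj : (discreteDomainGraph (Ω₀ \ K) δ).Adj x y := SimpleGraph.Walk.adj_of_mem_edges _ he
      obtain ⟨hm, -, -⟩ := discreteDomainGraph_adj_iff.1 hadj
      rw [meshGraph_adj_iff] at hm
      exact discreteDomainGraph_adj_iff.2 ⟨meshGraph_adj_iff.2 ⟨hm.1, hEdge _ he x y rfl⟩,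
        hDom x (SimpleGraph.Walk.fst_mem_support_of_mem_edges _ he),
        hDom y (SimpleGraph.Walk.snd_mem_support_of_mem_edges _ he)⟩
  refine ⟨⟨β₁.transfer _ hedges, ?_⟩, ?_⟩
  · rw [SimpleGraph.Walk.isPath_def, SimpleGraph.Walk.support_transfer, hβ₁supp]
    exact hrestnd
  · show γ.walk.support = αd ++ (β₁.transfer _ hedges).support
    rw [SimpleGraph.Walk.support_transfer, hβ₁supp, hsupp]

/-- **The domain Markov property of the critical SAW law** (all junk cases included): for a
bounded `Ω₀`, a self-avoiding prefix `α` of `(Ω₀ ∖ K)_δ` from `a` to `v`, new near data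
`K' = K ∪ δ·(α ∖ {v})`, and `b ∈ (Ω₀ ∖ K)_δ`, `b ∈ (Ω₀ ∖ K')_δ`:
`law (Ω₀∖K) {α ≼ γ ∧ suffix γ ∈ T} = law (Ω₀∖K) {α ≼ γ} · law (Ω₀∖K') {support ∈ T}` for
every set `T` of vertex lists, the suffix being `γ.support.drop |α|` (it starts at `v`).
[folklore] -/
theorem law_markov (hΩ₀ : Bornology.IsBounded Ω₀) (hδ : 0 < δ)
    (α : (discreteDomainGraph (Ω₀ \ K) δ).Walk a v) (hα : α.IsPath) {K' : Set ℂ}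
    (hK' : K' = K ∪ meshPoint δ '' {x | x ∈ α.support.dropLast})
    (hb : b ∈ meshDomain (Ω₀ \ K) δ) (hb' : b ∈ meshDomain (Ω₀ \ K') δ) (T : Set (List (Site 2))) :
    law (Ω₀ \ K) δ a b {γ | α.support <+: γ.walk.support ∧ γ.walk.support.drop α.length ∈ T} =
      law (Ω₀ \ K) δ a b {γ | α.support <+: γ.walk.support} *
        law (Ω₀ \ K') δ v b {β' | β'.walk.support ∈ T} := by
  have hlen : α.support.length - 1 = α.length := by
    rw [SimpleGraph.Walk.length_support]; rfl
  have h := law_cylinder_split (Ω := Ω₀ \ K) (Ω' := Ω₀ \ K') (a := a) (b := b) α.support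
    (SimpleGraph.Walk.support_ne_nil α) (SimpleGraph.Walk.getLast_support α)
    (markov_T1 α hα hb hK') (markov_T2 hδ α hK' hb')
    (weight_univ_ne_top (hΩ₀.subset Set.sdiff_subset) hδ v b) T
  rw [hlen] at h
  exact h

end Markov


end Summit.CriticalPhenomena.SAWScalingLimit.Theorems.ScreeningRecursion

end
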